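import Literature.Probability.LatticeModels.ProdBernoulliIndependence
import Literature.Probability.Percolation.PercolationProofs
import Literature.Probability.Percolation.PercolationEvents
import Summits.CriticalPhenomena.PercolationContinuityZ3.Theorems.PercNearOneGluingNoHeavyLowerTailOneLayerTwoFingerTools
import HarnessLib

/-!
# Hub graphs: the isolation events of the terminals as cylinder events, and their probabilities

Support file for crux `stmt-CriticalPhenomena-4575` (`NoHeavyLowerTail`), seat `prim-l12-p1` gen 19 (`--supports stmt-CriticalPhenomena-4575`).
Memo `run/shared/lean/prim/prim-l12/FROM-prim-l12-p1-g19-COMB-PLUS.md` §8; used by `…ThreePointHubGraphs.lean` (the three-point variance row on hub graphs).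

Bond percolation `prodBernoulli w` on a finite vertex type `V`, terminals `x y z` (pairwise distinct); the HUBS are the other vertices.  [this work]
* `isoEv x y z` — the cylinder event "the terminal pairs `xy, xz` are closed and no hub `h` has `s(x,h)` open together with `s(y,h)` or `s(z,h)`";
  `isoEv_iff`: off the null event `bad` (some hub–hub pair open) it IS the event `x ↮ y ∧ x ↮ z` (closure of `{x} ∪ {h : s(x,h) open}` under open adjacency).
* `real_isoEv`, `real_sepEv`: `P(isoEv)` and `P(isoEv a b c ∩ isoEv b a c)` factor over the hubs (pairwise disjoint pair triples,
  `prodBernoulli_real_inter_biInter_of_determinedBy`); `real_isoH`, `real_sepH`, `real_tClosed`, `real_tClosed_inter`: the single-hub and terminal factors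
  `1 − α(1−(1−β)(1−γ))`, `1 − αβ − αγ − βγ + 2αβγ`, `(1−w(xy))(1−w(xz))`, `(1−w(ab))(1−w(ac))(1−w(bc))`; `real_bad`: the null event is null on a hub graph.
-/

namespace Summit.CriticalPhenomena.PercolationContinuityZ3.Theorems.ThreePointHubEvents

open MeasureTheory Set
open Literature.Probability.Percolation Literature.Probability.LatticeModels

variable {V : Type*} [Fintype V] [DecidableEq V]

/-! ## Hubs, hub events, the null event -/

/-- The hubs: all vertices other than the three terminals. [this work] -/
def hubs (a b c : V) : Finset V := Finset.univ.filter fun v => v ≠ a ∧ v ≠ b ∧ v ≠ c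

/-- Membership in `hubs`. [this work] -/
@[simp] theorem mem_hubs {a b c v : V} : v ∈ hubs a b c ↔ v ≠ a ∧ v ≠ b ∧ v ≠ c := by
  simp [hubs]

/-- `hubs` is symmetric (swap of the first two terminals). [this work] -/
theorem hubs_swap12 (a b c : V) : hubs b a c = hubs a b c := by
  ext v; simp only [mem_hubs]; tauto

/-- `hubs` is symmetric (rotation). [this work] -/
theorem hubs_rot (a b c : V) : hubs c a b = hubs a b c := by
  ext v; simp only [mem_hubs]; tauto

/-- The three pairs of the hub `h`. [this work] -/
def starPairs (a b c h : V) : Finset (Sym2 V) := {s(a, h), s(b, h), s(c, h)}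

/-- The single-hub isolation event of the terminal `x` at the hub `h`: NOT (`s(x,h)` open and one of `s(y,h)`, `s(z,h)` open). [this work] -/
def isoH (x y z h : V) : Set (BondConfig V) := {ω | ¬ (s(x, h) ∈ ω ∧ (s(y, h) ∈ ω ∨ s(z, h) ∈ ω))}

/-- The terminal pairs of `x` are closed. [this work] -/
def tClosed (x y z : V) : Set (BondConfig V) := {ω | s(x, y) ∉ ω ∧ s(x, z) ∉ ω}

/-- The cylinder form of "`x` is isolated from `y` and `z`". [this work] -/
def isoEv (x y z : V) : Set (BondConfig V) := tClosed x y z ∩ ⋂ h ∈ hubs x y z, isoH x y z h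

/-- The null event: some pair of distinct hubs is open. [this work] -/
def bad (a b c : V) : Set (BondConfig V) := {ω | ∃ u v, u ∈ hubs a b c ∧ v ∈ hubs a b c ∧ u ≠ v ∧ s(u, v) ∈ ω}

/-- `bad` is symmetric (swap). [this work] -/
theorem bad_swap12 (a b c : V) : bad b a c = bad a b c := by
  simp only [bad, hubs_swap12]

/-- `bad` is symmetric (rotation). [this work] -/
theorem bad_rot (a b c : V) : bad c a b = bad a b c := by
  simp only [bad, hubs_rot]

/-! ## The closure argument: `isoEv x y z` is isolation of `x`, off the null event -/

section walks
variable {x y z : V} {ω : BondConfig V}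

/-- The set of vertices reachable from `x` when `x` is isolated: `x` itself and the hubs `h` with `s(x,h)` open. [this work] -/
def reachSet (x y z : V) (ω : BondConfig V) : Set V := {v | v = x ∨ (v ∈ hubs x y z ∧ s(x, v) ∈ ω)}

/-- `reachSet` is closed under open adjacency (on `isoEv`, off the null event). [this work] -/
theorem reachSet_closed (hω : ω ∈ isoEv x y z) (hN : ω ∉ bad x y z) {u v : V} (huv : (openGraph ω).Adj u v)
    (hu : u ∈ reachSet x y z ω) : v ∈ reachSet x y z ω := by
  rw [openGraph_adj] at huv
  obtain ⟨he, hne⟩ := huv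
  obtain ⟨hT, hI⟩ := hω
  simp only [mem_iInter] at hI
  rcases hu with rfl | ⟨huH, hxu⟩
  · -- `u = x`
    by_cases hvy : v = y
    · subst hvy; exact (hT.1 he).elim
    by_cases hvz : v = z
    · subst hvz; exact (hT.2 he).elim
    exact Or.inr ⟨mem_hubs.2 ⟨fun h => hne h.symm, hvy, hvz⟩, he⟩
  · -- `u` a hub with `s(x,u)` open
    by_cases hvx : v = x
    · exact Or.inl hvx
    have hiso := hI u huH
    simp only [isoH, mem_setOf_eq, not_and, not_or] at hiso
    by_cases hvy : v = y
    · subst hvy; exact ((hiso hxu).1 (by rw [Sym2.eq_swap]; exact he)).elim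
    by_cases hvz : v = z
    · subst hvz; exact ((hiso hxu).2 (by rw [Sym2.eq_swap]; exact he)).elim
    exact (hN ⟨u, v, huH, mem_hubs.2 ⟨hvx, hvy, hvz⟩, hne, he⟩).elim

/-- Open walks from `reachSet` stay in `reachSet`. [this work] -/
theorem walk_stays (hω : ω ∈ isoEv x y z) (hN : ω ∉ bad x y z) :
    ∀ {u v : V} (_ : (openGraph ω).Walk u v), u ∈ reachSet x y z ω → v ∈ reachSet x y z ω := by
  intro u v p
  induction p with
  | nil => exact id
  | cons h _ ih => exact fun hu => ih (reachSet_closed hω hN h hu)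

/-- **`isoEv x y z` is the isolation of `x` from `y` and `z`** (pairwise distinct terminals, off the null event). [this work] -/
theorem isoEv_iff (hxy : x ≠ y) (hxz : x ≠ z) (hN : ω ∉ bad x y z) :
    ω ∈ isoEv x y z ↔ ¬ (openGraph ω).Reachable x y ∧ ¬ (openGraph ω).Reachable x z := by
  constructor
  · intro hω
    have hx : x ∈ reachSet x y z ω := Or.inl rfl
    have hy : y ∉ reachSet x y z ω := by
      rintro (h | ⟨h, -⟩)
      · exact hxy h.symm
      · exact (mem_hubs.1 h).2.1 rfl
    have hz : z ∉ reachSet x y z ω := by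
      rintro (h | ⟨h, -⟩)
      · exact hxz h.symm
      · exact (mem_hubs.1 h).2.2 rfl
    exact ⟨fun ⟨p⟩ => hy (walk_stays hω hN p hx), fun ⟨p⟩ => hz (walk_stays hω hN p hx)⟩
  · rintro ⟨hy, hz⟩
    refine ⟨⟨fun h => hy ?_, fun h => hz ?_⟩, ?_⟩
    · exact SimpleGraph.Adj.reachable ((openGraph_adj ω x y).2 ⟨h, hxy⟩)
    · exact SimpleGraph.Adj.reachable ((openGraph_adj ω x z).2 ⟨h, hxz⟩)
    · simp only [mem_iInter]
      intro h hh
      obtain ⟨hhx, hhy, hhz⟩ := mem_hubs.1 hh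
      simp only [isoH, mem_setOf_eq, not_and, not_or]
      intro hxh
      have h1 : (openGraph ω).Reachable x h := SimpleGraph.Adj.reachable ((openGraph_adj ω x h).2 ⟨hxh, fun e => hhx e.symm⟩)
      refine ⟨fun hyh => hy (h1.trans ?_), fun hzh => hz (h1.trans ?_)⟩
      · exact SimpleGraph.Adj.reachable ((openGraph_adj ω h y).2 ⟨by rw [Sym2.eq_swap]; exact hyh, hhy⟩)
      · exact SimpleGraph.Adj.reachable ((openGraph_adj ω h z).2 ⟨by rw [Sym2.eq_swap]; exact hzh, hhz⟩)

end walks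

/-! ## Events determined by finitely many pairs -/

section det

omit [Fintype V] [DecidableEq V] in
/-- An event whose membership only depends on the pairs of `F` is determined by `F`. [this work] -/
theorem determinedBy_of_iff {A : Set (BondConfig V)} {F : Finset (Sym2 V)}
    (h : ∀ ω ω' : BondConfig V, (∀ e ∈ F, (e ∈ ω ↔ e ∈ ω')) → (ω ∈ A ↔ ω' ∈ A)) : DeterminedBy A (↑F : Set (Sym2 V)) := by
  rw [determinedBy_iff]
  intro ω ω' hF
  refine h ω ω' fun e he => ⟨fun h1 => ?_, fun h1 => ?_⟩
  · have : e ∈ ω' ∩ ↑F := by rw [← hF]; exact ⟨h1, he⟩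
    exact this.1
  · have : e ∈ ω ∩ ↑F := by rw [hF]; exact ⟨h1, he⟩
    exact this.1

omit [Fintype V] [DecidableEq V] in
/-- `isoH x y z h` is determined by any pair set containing `s(x,h), s(y,h), s(z,h)`. [this work] -/
theorem determinedBy_isoH {x y z h : V} {F : Finset (Sym2 V)} (hx : s(x, h) ∈ F) (hy : s(y, h) ∈ F) (hz : s(z, h) ∈ F) :
    DeterminedBy (isoH x y z h) (↑F : Set (Sym2 V)) := by
  refine determinedBy_of_iff fun ω ω' hF => ?_
  simp only [isoH, mem_setOf_eq, hF _ hx, hF _ hy, hF _ hz]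

omit [Fintype V] [DecidableEq V] in
/-- `tClosed x y z` is determined by any pair set containing `s(x,y), s(x,z)`. [this work] -/
theorem determinedBy_tClosed {x y z : V} {F : Finset (Sym2 V)} (hy : s(x, y) ∈ F) (hz : s(x, z) ∈ F) :
    DeterminedBy (tClosed x y z) (↑F : Set (Sym2 V)) := by
  refine determinedBy_of_iff fun ω ω' hF => ?_
  simp only [tClosed, mem_setOf_eq, hF _ hy, hF _ hz]

omit [Fintype V] [DecidableEq V] in
/-- A star pair `s(p,h)` (`p` a terminal, `h` a hub) differs from every star pair of another hub. [this work] -/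
theorem starPair_ne {x y z p q h h' : V} (hp : p = x ∨ p = y ∨ p = z) (hh : h ≠ h') (h'x : h' ≠ x) (h'y : h' ≠ y) (h'z : h' ≠ z) :
    s(p, h) ≠ s(q, h') := by
  intro e
  rcases Sym2.eq_iff.1 e with ⟨-, e2⟩ | ⟨e1, -⟩
  · exact hh e2
  · rcases hp with rfl | rfl | rfl
    · exact h'x e1.symm
    · exact h'y e1.symm
    · exact h'z e1.symm

/-- The star pair sets of distinct hubs are disjoint. [this work] -/
theorem pairwiseDisjoint_starPairs (x y z : V) :
    (↑(hubs x y z) : Set V).PairwiseDisjoint fun h => starPairs x y z h := by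
  intro h hh h' hh' hne
  have hh'' := mem_hubs.1 (Finset.mem_coe.1 hh')
  simp only [Function.onFun, starPairs, Finset.disjoint_left, Finset.mem_insert, Finset.mem_singleton]
  rintro e (rfl | rfl | rfl) (h1 | h1 | h1)
  all_goals first
    | exact starPair_ne (Or.inl rfl) hne hh''.1 hh''.2.1 hh''.2.2 h1
    | exact starPair_ne (Or.inr (Or.inl rfl)) hne hh''.1 hh''.2.1 hh''.2.2 h1
    | exact starPair_ne (Or.inr (Or.inr rfl)) hne hh''.1 hh''.2.1 hh''.2.2 h1

omit [Fintype V] [DecidableEq V] in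
/-- A terminal pair is not a star pair. [this work] -/
theorem termPair_ne_starPair {x y z p q r h : V} (hp : p = x ∨ p = y ∨ p = z) (hq : q = x ∨ q = y ∨ q = z) (hx : h ≠ x) (hy : h ≠ y)
    (hz : h ≠ z) : s(p, q) ≠ s(r, h) := by
  intro e
  rcases Sym2.eq_iff.1 e with ⟨-, e2⟩ | ⟨e1, -⟩
  · rcases hq with rfl | rfl | rfl
    · exact hx e2.symm
    · exact hy e2.symm
    · exact hz e2.symm
  · rcases hp with rfl | rfl | rfl
    · exact hx e1.symm
    · exact hy e1.symm
    · exact hz e1.symm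

/-- `tClosed x y z` is determined by the complement of all star pairs. [this work] -/
theorem determinedBy_tClosed_compl (x y z : V) :
    DeterminedBy (tClosed x y z) (⋃ h ∈ hubs x y z, (↑(starPairs x y z h) : Set (Sym2 V)))ᶜ := by
  refine (determinedBy_tClosed (F := {s(x, y), s(x, z)}) (by simp) (by simp)).mono ?_
  intro e he hU
  simp only [Finset.coe_insert, Finset.coe_singleton, mem_insert_iff, mem_singleton_iff] at he
  obtain ⟨h, hh, heh⟩ := mem_iUnion₂.1 hU
  obtain ⟨hhx, hhy, hhz⟩ := mem_hubs.1 (Finset.mem_coe.1 hh)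
  simp only [starPairs, Finset.coe_insert, Finset.coe_singleton, mem_insert_iff, mem_singleton_iff] at heh
  rcases he with rfl | rfl
  · rcases heh with e | e | e
    · exact termPair_ne_starPair (Or.inl rfl) (Or.inr (Or.inl rfl)) hhx hhy hhz e
    · exact termPair_ne_starPair (Or.inl rfl) (Or.inr (Or.inl rfl)) hhx hhy hhz e
    · exact termPair_ne_starPair (Or.inl rfl) (Or.inr (Or.inl rfl)) hhx hhy hhz e
  · rcases heh with e | e | e
    · exact termPair_ne_starPair (Or.inl rfl) (Or.inr (Or.inr rfl)) hhx hhy hhz e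
    · exact termPair_ne_starPair (Or.inl rfl) (Or.inr (Or.inr rfl)) hhx hhy hhz e
    · exact termPair_ne_starPair (Or.inl rfl) (Or.inr (Or.inr rfl)) hhx hhy hhz e

end det

/-! ## Single-hub and terminal probabilities -/

section prob
variable (w : Sym2 V → unitInterval)

omit [Fintype V] in
/-- `P(tClosed x y z) = (1 − w(xy))(1 − w(xz))` for `y ≠ z`. [this work] -/
theorem real_tClosed {x y z : V} (hyz : y ≠ z) :
    (prodBernoulli w).real (tClosed x y z) = (1 - (w s(x, y) : ℝ)) * (1 - (w s(x, z) : ℝ)) := by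
  have hset : tClosed x y z = {ω : BondConfig V | ∀ e ∈ ({s(x, y), s(x, z)} : Finset (Sym2 V)), e ∉ ω} := by
    ext ω; simp [tClosed]
  have hne : s(x, y) ≠ s(x, z) := by
    intro e
    rcases Sym2.eq_iff.1 e with ⟨-, e2⟩ | ⟨e1, e2⟩
    · exact hyz e2
    · exact hyz (e2.trans e1)
  rw [hset, prodBernoulli_real_forall_notMem, Finset.prod_pair hne]

/-- **Single-hub isolation probability**: `P(isoH x y z h) = 1 − w(xh)·(1 − (1 − w(yh))(1 − w(zh)))` (`x ≠ y`, `x ≠ z`, `y ≠ z`). [this work] -/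
theorem real_isoH {x y z h : V} (hxy : x ≠ y) (hxz : x ≠ z) (hyz : y ≠ z) :
    (prodBernoulli w).real (isoH x y z h) =
      1 - (w s(x, h) : ℝ) * (1 - (1 - (w s(y, h) : ℝ)) * (1 - (w s(z, h) : ℝ))) := by
  set X : Set (BondConfig V) := {ω | s(x, h) ∈ ω} with hX
  set YZ : Set (BondConfig V) := {ω | ∀ e ∈ ({s(y, h), s(z, h)} : Finset (Sym2 V)), e ∉ ω} with hYZ
  have hset : isoH x y z h = (X ∩ YZᶜ)ᶜ := by
    ext ω
    simp only [isoH, mem_setOf_eq, mem_compl_iff, mem_inter_iff, hX, hYZ, Finset.mem_insert, Finset.mem_singleton,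
      forall_eq_or_imp, forall_eq, not_and_or, not_not]
  have hyz' : s(y, h) ≠ s(z, h) := by
    intro e
    rcases Sym2.eq_iff.1 e with ⟨e1, -⟩ | ⟨e1, e2⟩
    · exact hyz e1
    · exact hyz (e1.trans e2)
  have hdisj : Disjoint ({s(x, h)} : Finset (Sym2 V)) {s(y, h), s(z, h)} := by
    rw [Finset.disjoint_singleton_left]
    simp only [Finset.mem_insert, Finset.mem_singleton, not_or]
    refine ⟨fun e => ?_, fun e => ?_⟩
    · rcases Sym2.eq_iff.1 e with ⟨e1, -⟩ | ⟨e1, e2⟩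
      · exact hxy e1
      · exact hxy (e1.trans e2)
    · rcases Sym2.eq_iff.1 e with ⟨e1, -⟩ | ⟨e1, e2⟩
      · exact hxz e1
      · exact hxz (e1.trans e2)
  have hXdet : DeterminedBy X (↑({s(x, h)} : Finset (Sym2 V)) : Set (Sym2 V)) :=
    determinedBy_of_iff fun ω ω' hF => by simp only [hX, mem_setOf_eq, hF _ (Finset.mem_singleton_self _)]
  have hYZdet : DeterminedBy YZᶜ (↑({s(y, h), s(z, h)} : Finset (Sym2 V)) : Set (Sym2 V)) := by
    refine OneLayerTwoFinger.determinedBy_compl (determinedBy_of_iff fun ω ω' hF => ?_)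
    simp only [hYZ, mem_setOf_eq]
    exact forall₂_congr fun e he => by rw [hF e he]
  have hXr : (prodBernoulli w).real X = w s(x, h) := prodBernoulli_real_setOf_mem w _
  have hYZr : (prodBernoulli w).real YZ = (1 - (w s(y, h) : ℝ)) * (1 - (w s(z, h) : ℝ)) := by
    rw [hYZ, prodBernoulli_real_forall_notMem, Finset.prod_pair hyz']
  have hYZc : (prodBernoulli w).real YZᶜ = 1 - (prodBernoulli w).real YZ := probReal_compl_eq_one_sub MeasurableSet.of_discrete
  rw [hset, probReal_compl_eq_one_sub MeasurableSet.of_discrete,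
    prodBernoulli_real_inter_of_determinedBy_disjoint w hdisj hXdet hYZdet MeasurableSet.of_discrete MeasurableSet.of_discrete,
    hXr, hYZc, hYZr]

/-- **Single-hub separation probability**: `P(isoH a b c h ∩ isoH b a c h) = 1 − αβ − αγ − βγ + 2αβγ` with `α = w(ah)`, `β = w(bh)`,
`γ = w(ch)` (inclusion–exclusion: the union of the two events is "not both `ah`, `bh` open"). [this work] -/
theorem real_sepH {a b c h : V} (hab : a ≠ b) (hac : a ≠ c) (hbc : b ≠ c) :
    (prodBernoulli w).real (isoH a b c h ∩ isoH b a c h) =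
      1 - (w s(a, h) : ℝ) * w s(b, h) - (w s(a, h) : ℝ) * w s(c, h) - (w s(b, h) : ℝ) * w s(c, h) +
        2 * (w s(a, h) : ℝ) * w s(b, h) * w s(c, h) := by
  have hU : isoH a b c h ∪ isoH b a c h = ({ω : BondConfig V | (↑({s(a, h), s(b, h)} : Finset (Sym2 V)) : Set (Sym2 V)) ⊆ ω})ᶜ := by
    ext ω
    simp only [isoH, mem_union, mem_setOf_eq, mem_compl_iff, Finset.coe_insert, Finset.coe_singleton, insert_subset_iff,
      singleton_subset_iff]
    tauto
  have hne : s(a, h) ≠ s(b, h) := by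
    intro e
    rcases Sym2.eq_iff.1 e with ⟨e1, -⟩ | ⟨e1, e2⟩
    · exact hab e1
    · exact hab (e1.trans e2)
  have hUr : (prodBernoulli w).real (isoH a b c h ∪ isoH b a c h) = 1 - (w s(a, h) : ℝ) * w s(b, h) := by
    rw [hU, probReal_compl_eq_one_sub MeasurableSet.of_discrete, prodBernoulli_real_subset, Finset.prod_pair hne]
  have hIE := measureReal_union_add_inter (μ := prodBernoulli w) (s := isoH a b c h) (t := isoH b a c h) MeasurableSet.of_discrete
  rw [hUr, real_isoH w hab hac hbc, real_isoH w (Ne.symm hab) hbc hac] at hIE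
  linarith

/-- **`P(isoEv x y z) = P(tClosed x y z) · ∏_h P(isoH x y z h)`** (independence of the hubs' pair triples). [this work] -/
theorem real_isoEv (x y z : V) :
    (prodBernoulli w).real (isoEv x y z) =
      (prodBernoulli w).real (tClosed x y z) * ∏ h ∈ hubs x y z, (prodBernoulli w).real (isoH x y z h) := by
  unfold isoEv
  exact prodBernoulli_real_inter_biInter_of_determinedBy w (hubs x y z) (fun h => starPairs x y z h) (pairwiseDisjoint_starPairs x y z)
    (fun h _ => determinedBy_isoH (by simp [starPairs]) (by simp [starPairs]) (by simp [starPairs]))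
    (fun _ _ => MeasurableSet.of_discrete) (determinedBy_tClosed_compl x y z) MeasurableSet.of_discrete

/-- The cylinder form of `sep`. [this work] -/
theorem isoEv_inter_isoEv (a b c : V) :
    isoEv a b c ∩ isoEv b a c = (tClosed a b c ∩ tClosed b a c) ∩ ⋂ h ∈ hubs a b c, (isoH a b c h ∩ isoH b a c h) := by
  ext ω
  simp only [isoEv, hubs_swap12, mem_inter_iff, mem_iInter]
  constructor
  · rintro ⟨⟨h1, h2⟩, h3, h4⟩; exact ⟨⟨h1, h3⟩, fun h hh => ⟨h2 h hh, h4 h hh⟩⟩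
  · rintro ⟨⟨h1, h3⟩, h2⟩; exact ⟨⟨h1, fun h hh => (h2 h hh).1⟩, h3, fun h hh => (h2 h hh).2⟩

/-- **`P(isoEv a b c ∩ isoEv b a c) = P(all terminal pairs closed) · ∏_h P(sepH h)`.** [this work] -/
theorem real_sepEv (a b c : V) :
    (prodBernoulli w).real (isoEv a b c ∩ isoEv b a c) =
      (prodBernoulli w).real (tClosed a b c ∩ tClosed b a c) *
        ∏ h ∈ hubs a b c, (prodBernoulli w).real (isoH a b c h ∩ isoH b a c h) := by
  rw [isoEv_inter_isoEv]
  refine prodBernoulli_real_inter_biInter_of_determinedBy w (hubs a b c) (fun h => starPairs a b c h) (pairwiseDisjoint_starPairs a b c)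
    (fun h _ => (determinedBy_isoH (by simp [starPairs]) (by simp [starPairs]) (by simp [starPairs])).inter
      (determinedBy_isoH (by simp [starPairs]) (by simp [starPairs]) (by simp [starPairs])))
    (fun _ _ => MeasurableSet.of_discrete) ((determinedBy_tClosed_compl a b c).inter ?_) MeasurableSet.of_discrete
  have h := determinedBy_tClosed_compl b a c
  rw [hubs_swap12] at h
  refine h.mono (compl_subset_compl.2 (iUnion₂_mono fun v _ => ?_))
  intro e he
  simp only [starPairs, Finset.coe_insert, Finset.coe_singleton, mem_insert_iff, mem_singleton_iff] at he ⊢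
  tauto

omit [Fintype V] in
/-- `P(all three terminal pairs closed) = (1 − w(ab))(1 − w(ac))(1 − w(bc))`. [this work] -/
theorem real_tClosed_inter {a b c : V} (hab : a ≠ b) (hac : a ≠ c) (hbc : b ≠ c) :
    (prodBernoulli w).real (tClosed a b c ∩ tClosed b a c) =
      (1 - (w s(a, b) : ℝ)) * (1 - (w s(a, c) : ℝ)) * (1 - (w s(b, c) : ℝ)) := by
  have hset : tClosed a b c ∩ tClosed b a c =
      {ω : BondConfig V | ∀ e ∈ ({s(a, b), s(a, c), s(b, c)} : Finset (Sym2 V)), e ∉ ω} := by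
    ext ω
    simp only [tClosed, mem_inter_iff, mem_setOf_eq, Finset.mem_insert, Finset.mem_singleton, forall_eq_or_imp, forall_eq,
      Sym2.eq_swap (a := b) (b := a)]
    tauto
  have h1 : s(a, b) ∉ ({s(a, c), s(b, c)} : Finset (Sym2 V)) := by
    simp only [Finset.mem_insert, Finset.mem_singleton, not_or]
    refine ⟨fun e => ?_, fun e => ?_⟩
    · rcases Sym2.eq_iff.1 e with ⟨-, e2⟩ | ⟨e1, e2⟩
      · exact hbc e2
      · exact hbc (e2.trans e1)
    · rcases Sym2.eq_iff.1 e with ⟨e1, -⟩ | ⟨e1, e2⟩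
      · exact hab e1
      · exact hac e1
  have h2 : s(a, c) ≠ s(b, c) := by
    intro e
    rcases Sym2.eq_iff.1 e with ⟨e1, -⟩ | ⟨e1, e2⟩
    · exact hab e1
    · exact hab (e1.trans e2)
  rw [hset, prodBernoulli_real_forall_notMem, Finset.prod_insert h1, Finset.prod_pair h2, mul_assoc]

/-- The null event has probability `0` on a hub graph. [this work] -/
theorem real_bad {a b c : V} (hw : ∀ u ∈ hubs a b c, ∀ v ∈ hubs a b c, u ≠ v → (w s(u, v) : ℝ) = 0) :
    (prodBernoulli w).real (bad a b c) = 0 := by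
  set P : Finset (Sym2 V) := ((hubs a b c ×ˢ hubs a b c).filter fun uv => uv.1 ≠ uv.2).image fun uv => s(uv.1, uv.2) with hP
  have hsub : bad a b c ⊆ {ω : BondConfig V | ∃ e ∈ P, e ∈ ω} := by
    rintro ω ⟨u, v, hu, hv, huv, he⟩
    refine ⟨s(u, v), ?_, he⟩
    rw [hP, Finset.mem_image]
    exact ⟨(u, v), Finset.mem_filter.2 ⟨Finset.mem_product.2 ⟨hu, hv⟩, huv⟩, rfl⟩
  refine le_antisymm ?_ measureReal_nonneg
  refine (measureReal_mono hsub).trans ((prodBernoulli_real_exists_mem_le_sum w P).trans (le_of_eq (Finset.sum_eq_zero ?_)))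
  intro e he
  rw [hP, Finset.mem_image] at he
  obtain ⟨⟨u, v⟩, huv, rfl⟩ := he
  rw [Finset.mem_filter, Finset.mem_product] at huv
  exact hw u huv.1.1 v huv.1.2 huv.2

end prob

end Summit.CriticalPhenomena.PercolationContinuityZ3.Theorems.ThreePointHubEvents
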